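import Summits.ResolutionOfSingularities.ResolutionOfSingularities.Theorems.PurelyInseparableDim4ResConeFormPersist
import HarnessLib
import HarnessLib.Audit.Tags

/-!
# Purely inseparable four-folds — the TAME CONE AT A CONSTANT-`d` STEP, X: the ANNIHILATOR LIFT — every form
# killing the old vertex lifts to one killing the new vertex by changing ONLY its chart coefficient
# (idea-4 g3 memo E2-WINDOW (I2), Λ-form: `Λ′ = ⟨ℓ̃₁ + c₁x_j′, ℓ̃₂ + c₂x_j′⟩`)

[OURS · counted 0 · cell `res-dim4-pi` · desk WORD #66 (2) (K2(p) lower-band lane, owner p-12 g2) · seat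
res-dim4-p-5 g2 · K lane crit-4 g2 (K-A4).]  Nothing here proves K2(p), `NoIsolatedTrap p p` or resolution of
singularities in dimension ≥ 4 / characteristic `p`.

Setting (`…ResCone*`): a shade-keeping band step `s →(j, b) s′`, polar kernels `V = resVertex s`, `V′ = resVertex s′`,
their annihilators `Λ = {φ | φ ⊥ V}`, `Λ′`, coefficient vectors `φ : Fin 4 → K` acting by `dotProduct`.  Changing the chart
coefficient of `φ` is `Function.update φ j a` (`= φ̃ + a·x_j` in idea-4's notation).

* `update_eq_add_single`, `dotProduct_update` — `update φ j a = φ + (a − φ_j)·e_j`, so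
  `(update φ j a)·w = φ·w + (a − φ_j) w_j`;
* **`exists_update_annihilates_step`** (FORWARD LIFT, any `e_G`, no constancy): `φ ⊥ V ⇒ ∃ a, update φ j a ⊥ V′`
  (annihilator transport kills `V′ ∩ H_j`; one transversal vector of `V′`, if any, fixes `a`);
* **`exists_update_annihilates_of_step`** (BACKWARD LIFT, constant `e_G`): `φ′ ⊥ V′ ⇒ ∃ a, update φ′ j a ⊥ V`
  (the equality case (I2) `V′ ∩ H_j = V ∩ H_j` and the transversal vector `e_j + b ∈ V`);
* **`update_annihilates_step_unique`** (constant `e_G`): the lifted chart coefficient is UNIQUE (`V′ ⊄ H_j`);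
* `not_single_annihilates`, `not_single_annihilates_step` — `x_j ∉ Λ` (the step direction has `j`-coordinate `1`)
  and, on a constant-`e_G` step, `x_j ∉ Λ′`.

Hence on a constant-`e_G` step restriction-off-`j` is a BIJECTION `Λ ≃ Λ′`: for `e_G = 2` with `Λ = ⟨ℓ₁, ℓ₂⟩` this is
idea-4's `Λ′ = ⟨ℓ̃₁ + c₁x_j, ℓ̃₂ + c₂x_j⟩` with unique `c`; for `e_G = 3` it is T-PERSIST (p672037) again.
[cite: CossartJannsenSaito2020, Thm. 3.10(4), Thm. 3.14, Thm. 9.3]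
bears_on: LADDER-RESOLUTION:D157-DOOR2 (res-dim4-pi · K2(p) = `RidgeBudget.NoAboveFloorTrap p p`, lower band).
Supports stmt-ResolutionOfSingularities-16155 (helper).
-/

set_option linter.dupNamespace false -- mandated namespace of this single-conjunct summit

noncomputable section

namespace Summit.ResolutionOfSingularities.ResolutionOfSingularities.Theorems.PIDim4

namespace ResCone

open MvPolynomial Finset
open Literature.AlgebraicGeometry.Resolution
open Literature.AlgebraicGeometry.Resolution.CentreBlowup
open Literature.AlgebraicGeometry.Resolution.Hauser2010
open Literature.AlgebraicGeometry.Resolution.HauserPerlega2019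
open PointBlowup (polarMap additiveSubspace direction)

variable {K : Type} [Field K]

/-! ## 1. Changing one coefficient of a form -/

/-- `update φ j a = φ + (a − φ_j)·e_j`. [folklore] -/
theorem update_eq_add_single (φ : Fin 4 → K) (j : Fin 4) (a : K) :
    Function.update φ j a = φ + Pi.single j (a - φ j) := by
  funext i
  by_cases hij : i = j
  · rw [hij, Function.update_self, Pi.add_apply, Pi.single_eq_same]; ring
  · rw [Function.update_of_ne hij, Pi.add_apply, Pi.single_eq_of_ne hij, add_zero]

/-- `(update φ j a)·w = φ·w + (a − φ_j)·w_j`. [folklore] -/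
theorem dotProduct_update (φ : Fin 4 → K) (j : Fin 4) (a : K) (w : Fin 4 → K) :
    dotProduct (Function.update φ j a) w = dotProduct φ w + (a - φ j) * w j := by
  rw [update_eq_add_single, add_dotProduct, single_dotProduct]

/-- `e_j` as a form does not kill a vector with `w_j ≠ 0`. [folklore] -/
theorem single_one_dotProduct_eq (j : Fin 4) (w : Fin 4 → K) : dotProduct (Pi.single j (1 : K)) w = w j := by
  rw [single_dotProduct, one_mul]

/-! ## 2. The lifts -/

section Step

variable [DecidableEq K]

/-- **FORWARD ANNIHILATOR LIFT** (any `e_G`, no constancy): at a shade-keeping band step `s →(j, b) s′`, every form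
`φ` killing `resVertex s` becomes, after changing ONLY its chart coefficient, a form killing `resVertex s′`:
`∃ a, update φ j a ⊥ resVertex s′`. [OURS] [cite: CossartJannsenSaito2020, Thm. 3.10(4), Thm. 9.3] -/
theorem exists_update_annihilates_step {q : ℕ} (j : Fin 4) {b : Fin 4 → K} (hbj : b j = 0) {s : State K}
    {o : ℕ} (ho : ordZero s.F = o) (hr : ∀ d ∈ s.F.support, s.r ≤ d) (hqo : q < o) (ho2 : o < 2 * q)
    (heq : (CentreBlowup.step q Finset.univ j b s).shade = s.shade) {φ : Fin 4 → K}
    (hφ : ∀ w ∈ resVertex s, dotProduct φ w = 0) :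
    ∃ a : K, ∀ w ∈ resVertex (CentreBlowup.step q Finset.univ j b s), dotProduct (Function.update φ j a) w = 0 := by
  have htr : ∀ w ∈ resVertex (CentreBlowup.step q Finset.univ j b s), w j = 0 → dotProduct φ w = 0 :=
    fun w hw hwj => dotProduct_eq_zero_of_mem_resVertex_step j hbj ho hr hqo ho2 heq hφ hw hwj
  by_cases hex : ∃ u ∈ resVertex (CentreBlowup.step q Finset.univ j b s), u j ≠ 0
  · obtain ⟨u, hu, huj⟩ := hex
    refine ⟨φ j - dotProduct φ u / u j, fun w hw => ?_⟩
    -- `φ·w = (w_j / u_j)·(φ·u)` by transport on `w − (w_j/u_j)•u ∈ V′ ∩ H_j`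
    have h0 := htr (w - (w j / u j) • u) (Submodule.sub_mem _ hw (Submodule.smul_mem _ _ hu)) (by
      rw [Pi.sub_apply, Pi.smul_apply, smul_eq_mul, div_mul_cancel₀ _ huj, sub_self])
    rw [dotProduct_sub, dotProduct_smul, smul_eq_mul, sub_eq_zero] at h0
    rw [dotProduct_update, h0]
    field_simp
    ring
  · push Not at hex
    refine ⟨φ j, fun w hw => ?_⟩
    rw [Function.update_eq_self]
    exact htr w hw (hex w hw)

/-- **BACKWARD ANNIHILATOR LIFT** (constant `e_G`): at a shade-keeping band step with `e_G(s′) = e_G(s)`, every form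
`φ′` killing `resVertex s′` becomes, after changing only its chart coefficient, a form killing `resVertex s`
((I2) `V′ ∩ H_j = V ∩ H_j` and the transversal vector `e_j + b ∈ V`). [OURS]
[cite: CossartJannsenSaito2020, Thm. 3.10(4), Thm. 9.3] -/
theorem exists_update_annihilates_of_step {q : ℕ} (j : Fin 4) {b : Fin 4 → K} (hbj : b j = 0) {s : State K}
    {o : ℕ} (ho : ordZero s.F = o) (hr : ∀ d ∈ s.F.support, s.r ≤ d) (hqo : q < o) (ho2 : o < 2 * q)
    (heq : (CentreBlowup.step q Finset.univ j b s).shade = s.shade)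
    (he : Module.finrank K (resVertex (CentreBlowup.step q Finset.univ j b s)) =
      Module.finrank K (resVertex s)) {φ' : Fin 4 → K}
    (hφ' : ∀ w ∈ resVertex (CentreBlowup.step q Finset.univ j b s), dotProduct φ' w = 0) :
    ∃ a : K, ∀ w ∈ resVertex s, dotProduct (Function.update φ' j a) w = 0 := by
  have hI2 := resVertex_step_inf_hyperplane_eq_of_finrank_eq j hbj ho hr hqo ho2 heq he
  have htr : ∀ w ∈ resVertex s, w j = 0 → dotProduct φ' w = 0 := fun w hw hwj => by
    have hmem : w ∈ resVertex (CentreBlowup.step q Finset.univ j b s) ⊓ hyperplane j := by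
      rw [hI2]; exact Submodule.mem_inf.mpr ⟨hw, mem_hyperplane.mpr hwj⟩
    exact hφ' w (Submodule.mem_inf.mp hmem).1
  have hv := direction_mem_resVertex_of_shade_eq j hbj ho hr hqo ho2 heq
  refine ⟨φ' j - dotProduct φ' (direction j b), fun w hw => ?_⟩
  have h0 := htr (w - w j • direction j b) (Submodule.sub_mem _ hw (Submodule.smul_mem _ _ hv)) (by
    rw [Pi.sub_apply, Pi.smul_apply, smul_eq_mul, direction_apply_self, mul_one, sub_self])
  rw [dotProduct_sub, dotProduct_smul, smul_eq_mul, sub_eq_zero] at h0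
  rw [dotProduct_update, h0]
  ring

/-- **The lifted chart coefficient is UNIQUE on a constant-`e_G` step** (the new vertex is transverse to `H_j`).
[OURS] [cite: CossartJannsenSaito2020, Thm. 3.10(4)] -/
theorem update_annihilates_step_unique {q : ℕ} (j : Fin 4) {b : Fin 4 → K} (hbj : b j = 0) {s : State K}
    {o : ℕ} (ho : ordZero s.F = o) (hr : ∀ d ∈ s.F.support, s.r ≤ d) (hqo : q < o) (ho2 : o < 2 * q)
    (heq : (CentreBlowup.step q Finset.univ j b s).shade = s.shade)
    (he : Module.finrank K (resVertex (CentreBlowup.step q Finset.univ j b s)) =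
      Module.finrank K (resVertex s)) {φ : Fin 4 → K} {a a' : K}
    (ha : ∀ w ∈ resVertex (CentreBlowup.step q Finset.univ j b s), dotProduct (Function.update φ j a) w = 0)
    (ha' : ∀ w ∈ resVertex (CentreBlowup.step q Finset.univ j b s), dotProduct (Function.update φ j a') w = 0) :
    a = a' := by
  by_contra hne
  apply not_resVertex_step_le_hyperplane_of_finrank_eq j hbj ho hr hqo ho2 heq he
  intro u hu
  have h := ha u hu
  rw [dotProduct_update] at h
  have h' := ha' u hu
  rw [dotProduct_update] at h'
  have hd : (a - a') * u j = 0 := by linear_combination h - h'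
  exact mem_hyperplane.mpr ((mul_eq_zero.mp hd).resolve_left (sub_ne_zero.mpr hne))

/-- **`x_j ∉ Λ`**: the chart coordinate form does not kill the old vertex (the step direction `e_j + b ∈ resVertex s`
has `j`-coordinate `1`). [OURS] [cite: CossartJannsenSaito2020, Thm. 3.14] -/
theorem not_single_annihilates {q : ℕ} (j : Fin 4) {b : Fin 4 → K} (hbj : b j = 0) {s : State K} {o : ℕ}
    (ho : ordZero s.F = o) (hr : ∀ d ∈ s.F.support, s.r ≤ d) (hqo : q < o) (ho2 : o < 2 * q)
    (heq : (CentreBlowup.step q Finset.univ j b s).shade = s.shade) :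
    ¬ ∀ w ∈ resVertex s, dotProduct (Pi.single j (1 : K)) w = 0 := fun h => by
  have h1 := h _ (direction_mem_resVertex_of_shade_eq j hbj ho hr hqo ho2 heq)
  rw [single_one_dotProduct_eq, direction_apply_self] at h1
  exact one_ne_zero h1

/-- **`x_j ∉ Λ′` on a constant-`e_G` step**: the chart coordinate form does not kill the new vertex either
(transversality). [OURS] [cite: CossartJannsenSaito2020, Thm. 3.10(4)] -/
theorem not_single_annihilates_step {q : ℕ} (j : Fin 4) {b : Fin 4 → K} (hbj : b j = 0) {s : State K}
    {o : ℕ} (ho : ordZero s.F = o) (hr : ∀ d ∈ s.F.support, s.r ≤ d) (hqo : q < o) (ho2 : o < 2 * q)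
    (heq : (CentreBlowup.step q Finset.univ j b s).shade = s.shade)
    (he : Module.finrank K (resVertex (CentreBlowup.step q Finset.univ j b s)) =
      Module.finrank K (resVertex s)) :
    ¬ ∀ w ∈ resVertex (CentreBlowup.step q Finset.univ j b s), dotProduct (Pi.single j (1 : K)) w = 0 := by
  intro h
  apply not_resVertex_step_le_hyperplane_of_finrank_eq j hbj ho hr hqo ho2 heq he
  intro u hu
  have h1 := h u hu
  rw [single_one_dotProduct_eq] at h1
  exact mem_hyperplane.mpr h1

end Step

end ResCone

end Summit.ResolutionOfSingularities.ResolutionOfSingularities.Theorems.PIDim4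

end
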